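import Mathlib
import Summits.Ventures.PercRepro2.Defs
import Summits.Ventures.PercRepro2.Graph
import Summits.Ventures.PercRepro2.OneColourSwitch
import Summits.Ventures.PercRepro2.RegionHubSign
import Summits.Ventures.PercRepro2.SideSwitch
import Summits.Ventures.PercRepro2.TermSwitchDefs
import Summits.Ventures.PercRepro2.M9NoPocketDefs
import Summits.Ventures.PercRepro2.M9GeneralDSplit
import Summits.Ventures.PercRepro2.M9LinkedHD
import Summits.Ventures.PercRepro2.M9FourParts
import Summits.Ventures.PercRepro2.M9PsiOneDefs
import Summits.Ventures.PercRepro2.M9PsiOneWorlds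
import Summits.Ventures.PercRepro2.M9PsiOneWorldsM
import Summits.Ventures.PercRepro2.M9PsiOneSurvive
import Summits.Ventures.PercRepro2.M9PsiOneLink
import Summits.Ventures.PercRepro2.M9PsiOneLinkW
import Summits.Ventures.PercRepro2.M9PsiOneSigma
import Summits.Ventures.PercRepro2.M9PsiOneInj

/-!
# THEOREM Ψ₁: the payment of the doubly-reached points (blind cell PercRepro2, p3 g31,
2026-08-28; `proofs/P3-PAYMENT.md` §2)

For a graph with no edge at `d` to `r, s` and no `r–s` edge: the partner map `Ψ₁` sends the
doubly-reached colourings with `σ_rs = +1` (`exPlusSet`) injectively into the one-sided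
`K`-colourings of `Sep ∧ DOne(d)` (`psiOne_mem_kOnly`), with `σ_rs(Ψ₁ ω) = 1` and
`σ_pq(Ψ₁ ω) ≤ −σ_pq(ω)`.  Hence
  `Σ_{exPlusSet} σ_pq + Σ_{Ψ₁(exPlusSet)} σ_pq σ_rs ≤ 0`   (`exPlus_add_image_nonpos`),
and with the colour flip `exSum = 2 Σ_{exPlusSet} σ_pq` (`exSum_eq_two_mul_exPlus`):
  `exSum + 2 Σ_{Ψ₁(exPlusSet)} σ_pq σ_rs ≤ 0`   (`exSum_add_two_mul_image_nonpos`) —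
the doubly-reached part of the single-`d` sum is paid by a set of one-sided `K`-points of the
same size.  Own work; std axioms.
-/

namespace Summit.Ventures.PercRepro2

namespace NoPocket

open Finset Classical RegionHub OneColourSwitch SideSwitch TermSwitch

variable {V : Type*} {E : Type*}

section Sum

variable [Fintype E] [DecidableEq E] {ends : E → Sym2 V} {p q r s d : V}

/-- The doubly-reached colourings with `σ_rs = +1`: `IsEX`, `r ~_Y s`, `r ≁_W s`. -/
noncomputable def exPlusSet (ends : E → Sym2 V) (p q r s d : V) : Finset (Config E) :=
  univ.filter (fun ω => IsEX ends p q r s d ω ∧ Conn ends ω r s ∧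
    ¬ Conn ends (OneColourSwitch.compl ω) r s)

/-- Membership in `exPlusSet`. -/
lemma mem_exPlusSet {ω : Config E} :
    ω ∈ exPlusSet ends p q r s d ↔ IsEX ends p q r s d ω ∧ Conn ends ω r s ∧
      ¬ Conn ends (OneColourSwitch.compl ω) r s := by
  simp [exPlusSet]

/-- **The image of `Ψ₁` consists of one-sided `K`-points of `Sep ∧ DOne(d)`.** -/
theorem psiOne_mem_kOnly {ω : Config E} (hω : ω ∈ exPlusSet ends p q r s d) :
    sep2 ends p q r s (psiOne ends r s d ω) ∧ DOne ends r s d (psiOne ends r s d ω) ∧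
      d ∈ K2 ends r s (psiOne ends r s d ω) ∧ d ∉ M2 ends r s (psiOne ends r s d ω) := by
  obtain ⟨h, _, _⟩ := mem_exPlusSet.1 hω
  exact ⟨sep2_psiOne h, DOne_psiOne h, mem_K2_psiOne h, not_mem_M2_psiOne h⟩

/-- **`Ψ₁` is injective on `exPlusSet`.** -/
theorem psiOne_injOn_exPlus (hrs : ∀ e, ends e ≠ s(r, s)) :
    Set.InjOn (psiOne ends r s d) ↑(exPlusSet ends p q r s d) := by
  refine (psiOne_injOn (p := p) (q := q) hrs).mono ?_
  intro ω hω
  obtain ⟨h, _, hW⟩ := mem_exPlusSet.1 (Finset.mem_coe.1 hω)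
  exact ⟨h, hW⟩

/-- **The payment**: `Σ_{exPlusSet} σ_pq + Σ_{Ψ₁(exPlusSet)} σ_pq σ_rs ≤ 0`. -/
theorem exPlus_add_image_nonpos (hrs : ∀ e, ends e ≠ s(r, s)) :
    (∑ ω ∈ exPlusSet ends p q r s d, sigma ends ω p q) +
      ∑ ω ∈ (exPlusSet ends p q r s d).image (psiOne ends r s d),
        sigma ends ω p q * sigma ends ω r s ≤ 0 := by
  rw [Finset.sum_image (psiOne_injOn_exPlus hrs), ← Finset.sum_add_distrib]
  refine Finset.sum_nonpos (fun ω hω => ?_)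
  obtain ⟨h, hY, _⟩ := mem_exPlusSet.1 hω
  rw [sigma_rs_psiOne h hrs hY, mul_one]
  have := sigma_psiOne_le_neg h (p := p) (q := q)
  linarith

/-- The `σ_rs = −1` doubly-reached colourings are the colour flips of the `σ_rs = +1` ones. -/
lemma exMinus_sum_eq :
    (∑ ω : Config E, if IsEX ends p q r s d ω ∧ ¬ Conn ends ω r s ∧
        Conn ends (OneColourSwitch.compl ω) r s then sigma ends ω p q * sigma ends ω r s else 0) =
      ∑ ω : Config E, if IsEX ends p q r s d ω ∧ Conn ends ω r s ∧
        ¬ Conn ends (OneColourSwitch.compl ω) r s then sigma ends ω p q * sigma ends ω r s else 0 := by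
  refine Fintype.sum_equiv complPerm _ _ (fun ω => ?_)
  simp only [complPerm, Function.Involutive.coe_toPerm]
  rw [OneColourSwitch.compl_compl, sigma_compl_eq_neg, sigma_compl_eq_neg, neg_mul_neg]
  by_cases hE : IsEX ends p q r s d ω
  · have hE' : IsEX ends p q r s d (OneColourSwitch.compl ω) :=
      ⟨sep2_compl.2 hE.sep, DOne_compl hE.done, by rw [K2_compl]; exact hE.inM,
        by rw [M2_compl]; exact hE.inK, hE.noT, hE.hr, hE.hs, hE.hrs⟩
    simp only [hE, hE', true_and]
    by_cases a : Conn ends ω r s <;> by_cases b : Conn ends (OneColourSwitch.compl ω) r s <;>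
      simp [a, b]
  · have hE' : ¬ IsEX ends p q r s d (OneColourSwitch.compl ω) := fun hE' => hE
      ⟨sep2_compl.1 hE'.sep, by
        have := DOne_compl hE'.done; rwa [OneColourSwitch.compl_compl] at this,
        by have := hE'.inM; rwa [M2_compl] at this,
        by have := hE'.inK; rwa [K2_compl] at this, hE'.noT, hE'.hr, hE'.hs, hE'.hrs⟩
    simp [hE, hE']

/-- The `σ_rs = +1` part of the doubly-reached sum is `Σ_{exPlusSet} σ_pq`. -/
lemma exPlus_sum_eq :
    (∑ ω : Config E, if IsEX ends p q r s d ω ∧ Conn ends ω r s ∧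
        ¬ Conn ends (OneColourSwitch.compl ω) r s then sigma ends ω p q * sigma ends ω r s else 0) =
      ∑ ω ∈ exPlusSet ends p q r s d, sigma ends ω p q := by
  rw [exPlusSet, Finset.sum_filter]
  refine Finset.sum_congr rfl (fun ω _ => ?_)
  by_cases hω : IsEX ends p q r s d ω ∧ Conn ends ω r s ∧ ¬ Conn ends (OneColourSwitch.compl ω) r s
  · rw [if_pos hω, if_pos hω]
    unfold sigma
    rw [if_pos hω.2.1, if_neg hω.2.2]
    ring
  · rw [if_neg hω, if_neg hω]

omit [Fintype E] [DecidableEq E] in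
/-- The doubly-reached term of an `EX` colouring splits by the sign of `σ_rs` (no edge at `d`
to `r, s`). -/
lemma ex_term_split (hT : ∀ e, ends e ≠ s(d, r) ∧ ends e ≠ s(d, s)) (hr : d ≠ r) (hs : d ≠ s)
    (hrs : r ≠ s) (ω : Config E) :
    (if sep2 ends p q r s ω ∧ DOne ends r s d ω ∧ (d ∈ K2 ends r s ω ∧ d ∈ M2 ends r s ω)
        then sigma ends ω p q * sigma ends ω r s else 0) =
      (if IsEX ends p q r s d ω ∧ Conn ends ω r s ∧ ¬ Conn ends (OneColourSwitch.compl ω) r s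
        then sigma ends ω p q * sigma ends ω r s else 0) +
      (if IsEX ends p q r s d ω ∧ ¬ Conn ends ω r s ∧ Conn ends (OneColourSwitch.compl ω) r s
        then sigma ends ω p q * sigma ends ω r s else 0) := by
  by_cases hE : sep2 ends p q r s ω ∧ DOne ends r s d ω ∧ (d ∈ K2 ends r s ω ∧ d ∈ M2 ends r s ω)
  · have hEX : IsEX ends p q r s d ω := ⟨hE.1, hE.2.1, hE.2.2.1, hE.2.2.2, hT, hr, hs, hrs⟩
    rw [if_pos hE]
    by_cases a : Conn ends ω r s <;> by_cases b : Conn ends (OneColourSwitch.compl ω) r s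
    · rw [if_neg (fun h => h.2.2 b), if_neg (fun h => h.2.1 a)]
      unfold sigma; rw [if_pos a, if_pos b]; ring
    · rw [if_pos ⟨hEX, a, b⟩, if_neg (fun h => h.2.1 a), add_zero]
    · rw [if_neg (fun h => a h.2.1), if_pos ⟨hEX, a, b⟩, zero_add]
    · rw [if_neg (fun h => a h.2.1), if_neg (fun h => b h.2.2)]
      unfold sigma; rw [if_neg a, if_neg b]; ring
  · have hnE : ¬ IsEX ends p q r s d ω := fun hEX => hE ⟨hEX.sep, hEX.done, hEX.inK, hEX.inM⟩
    rw [if_neg hE, if_neg (fun h => hnE h.1), if_neg (fun h => hnE h.1), add_zero]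

/-- **`exSum = 2 Σ_{exPlusSet} σ_pq`** (no edge at `d` to `r, s`). -/
theorem exSum_eq_two_mul_exPlus (hT : ∀ e, ends e ≠ s(d, r) ∧ ends e ≠ s(d, s)) (hr : d ≠ r)
    (hs : d ≠ s) (hrs : r ≠ s) :
    exSum ends p q r s d = 2 * ∑ ω ∈ exPlusSet ends p q r s d, sigma ends ω p q := by
  unfold exSum
  rw [Finset.sum_congr rfl (fun ω _ => ex_term_split hT hr hs hrs ω), Finset.sum_add_distrib,
    exMinus_sum_eq, exPlus_sum_eq]
  ring

/-- **THEOREM Ψ₁, summed: `exSum + 2 Σ_{Ψ₁(exPlusSet)} σ_pq σ_rs ≤ 0`** — the doubly-reached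
part of the single-`d` sum is paid by the one-sided `K`-points `Ψ₁(exPlusSet)`
(`psiOne_mem_kOnly`), a set of the same size (`psiOne_injOn_exPlus`). -/
theorem exSum_add_two_mul_image_nonpos (hT : ∀ e, ends e ≠ s(d, r) ∧ ends e ≠ s(d, s))
    (hr : d ≠ r) (hs : d ≠ s) (hrs : r ≠ s) (hrs' : ∀ e, ends e ≠ s(r, s)) :
    exSum ends p q r s d + 2 * ∑ ω ∈ (exPlusSet ends p q r s d).image (psiOne ends r s d),
      sigma ends ω p q * sigma ends ω r s ≤ 0 := by
  rw [exSum_eq_two_mul_exPlus hT hr hs hrs]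
  have := exPlus_add_image_nonpos (p := p) (q := q) (d := d) hrs'
  linarith

end Sum

end NoPocket

end Summit.Ventures.PercRepro2
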